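/-
Copyright (c) 2026 the pub-hodgecm-mathlib formalisation cell (harness21).  Prover seat hodgecm-mathlib-F0P3a-p03 (g25): N8-INNER road,
brick (10)(C′) «CORNER EP PACKAGE», step (s1) GLUE (ray consumer of the arrangement gluing theorem).
-/
import Literature.Analysis.Calculus.SmoothGluingAcrossHyperplaneArrangement
import Literature.Analysis.Calculus.SmoothGluingAcrossHyperplaneRay
import Mathlib.LinearAlgebra.StdBasis
import HarnessLib

/-!
# Smooth gluing across a finite transversal arrangement — RAY CONSUMER FORM

Fifth file of the `SmoothGluingAcrossHyperplane` kit (everything PROVED; no definition, no named fact, no `sorry`).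

★ `contDiffOn_extendFrom_of_arrangement` glues a function `f`, `C^∞` off a finite transversal arrangement of affine hyperplanes
`{ℓ i = a i}` with locally bounded jets, into a `C^∞` function on `U`, PROVIDED the glue is already known to be `C^∞` near every
SIMPLE wall point (a point of exactly one wall).  ★ `contDiffOn_extendFrom_of_tendsto_iteratedFDeriv_ray_basis` produces exactly that
local smoothness across ONE wall from the agreement of the two one-sided limits of `t ↦ Dⁿf (x + t • v) (b k₁, …, b kₙ)` along one
transversal ray, tested on the words of a basis `b`.  This file composes the two:

* `contDiffOn_extendFrom_of_arrangement_of_ray_basis` — arrangement gluing with the simple-point hypothesis replaced by RAY-WORD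
  one-sided limits at the simple points of each wall (one transversal direction `v i` per wall);
* `contDiffOn_extendFrom_offWalls02_12_of_ray_basis` — the specialisation used by the rank-two archimedean corner package: `E = Fin 3 → ℝ`
  (angle letters), the two walls `{x 0 = x 2}` and `{x 1 = x 2}`, words in the coordinate basis `Pi.single j 1`;
* `exists_contDiffOn_eqOn_offWalls02_12_of_ray_basis` — the same packaged as «there is a `C^∞` function on `U` equal to `f` off the walls».

This is the one-place jump calculus of [Bouaziz 1994, §3.2 (I₁)–(I₂) p. 579] read as a gluing statement: zero jumps of all ray jets
across each wall (off the corners) plus local jet bounds force smoothness across the whole arrangement, corners included.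
-/

open Set Filter Metric Function
open scoped Topology ContDiff

namespace Literature.Analysis.Calculus

variable {E : Type*} [NormedAddCommGroup E] [NormedSpace ℝ E]
  {F : Type*} [NormedAddCommGroup F] [NormedSpace ℝ F] [CompleteSpace F]

/-! ### §1 The generic ray consumer -/

section Arrangement

variable {ι : Type*} (ℓ : ι → E →L[ℝ] ℝ) (a : ι → ℝ)

/-- **SMOOTH GLUING ACROSS A FINITE TRANSVERSAL ARRANGEMENT — RAY CONSUMER FORM.**  As ★ `contDiffOn_extendFrom_of_arrangement`
(`U` open; walls `(ℓ i, a i)`, `i ∈ T`, nonzero and transversal; `f` `C^∞` on `s := U ∩ {∀ i ∈ T, ℓ i ≠ a i}`; every jet `Dⁿf` bounded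
on `s` near each wall point), with the local smoothness of the glue at SIMPLE wall points replaced by: for each wall `i` a direction
`v i` transversal to it (`ℓ i (v i) ≠ 0`) such that at every simple point `x` of the wall `i` in `U` and for every word `k` in a basis
`b` of `E`, the two one-sided limits of `t ↦ Dⁿf (x + t • v i) (b (k 1), …, b (k n))` at `t = 0` exist and AGREE.  Then
`extendFrom s f` is `C^∞` on `U`. [cite: Bouaziz1994IntegralesOrbitales, §3.2 (I₁)–(I₂) p. 579] -/
theorem contDiffOn_extendFrom_of_arrangement_of_ray_basis {κ : Type*} (b : Module.Basis κ ℝ E) (T : Finset ι)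
    (hℓ : ∀ i ∈ T, ℓ i ≠ 0) {U : Set E} (hU : IsOpen U)
    (htrans : ∀ i ∈ T, ∀ x ∈ U, ℓ i x = a i → ∃ v : E, ℓ i v = 0 ∧ ∀ j ∈ T, j ≠ i → ℓ j x = a j → ℓ j v ≠ 0)
    {f : E → F} (hf : ContDiffOn ℝ ∞ f (U ∩ {y | ∀ i ∈ T, ℓ i y ≠ a i}))
    (hb : ∀ x ∈ U, (∃ i ∈ T, ℓ i x = a i) → ∀ n : ℕ, ∃ C : ℝ, ∀ᶠ y in 𝓝 x, (∀ i ∈ T, ℓ i y ≠ a i) → ‖iteratedFDeriv ℝ n f y‖ ≤ C)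
    (v : ι → E) (hv : ∀ i ∈ T, ℓ i (v i) ≠ 0)
    (hj : ∀ i ∈ T, ∀ x ∈ U, ℓ i x = a i → (∀ j ∈ T, j ≠ i → ℓ j x ≠ a j) → ∀ (n : ℕ) (k : Fin n → κ), ∃ l : F,
      Tendsto (fun t : ℝ => iteratedFDeriv ℝ n f (x + t • v i) fun m => b (k m)) (𝓝[>] 0) (𝓝 l) ∧
      Tendsto (fun t : ℝ => iteratedFDeriv ℝ n f (x + t • v i) fun m => b (k m)) (𝓝[<] 0) (𝓝 l)) :
    ContDiffOn ℝ ∞ (extendFrom (U ∩ {y | ∀ i ∈ T, ℓ i y ≠ a i}) f) U := by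
  classical
  refine contDiffOn_extendFrom_of_arrangement ℓ a T hℓ hU htrans hf hb fun i hi x hx hxi hsim => ?_
  -- a neighbourhood `V` of the simple point `x` inside `U` avoiding the other walls
  set V : Set E := U ∩ {y | ∀ j ∈ T.erase i, ℓ j y ≠ a j} with hVdef
  have hVo : IsOpen V := hU.inter (isOpen_setOf_forall_apply_ne ℓ a (T.erase i))
  have hxV : x ∈ V := ⟨hx, fun j hj => hsim j (Finset.mem_of_mem_erase hj) (Finset.ne_of_mem_erase hj)⟩
  -- on `V`, «regular for the wall `i`» is «regular for all the walls»
  have hiff : ∀ y ∈ V, (ℓ i y ≠ a i ↔ ∀ j ∈ T, ℓ j y ≠ a j) := by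
    intro y hyV
    refine ⟨fun hyi j hj => ?_, fun h => h i hi⟩
    by_cases hji : j = i
    · subst hji; exact hyi
    · exact hyV.2 j (Finset.mem_erase.2 ⟨hji, hj⟩)
  -- one-wall gluing on `V`
  have hG : ContDiffOn ℝ ∞ (extendFrom (V ∩ {y | ℓ i y ≠ a i}) f) V := by
    refine contDiffOn_extendFrom_of_tendsto_iteratedFDeriv_ray_basis (ℓ i) (a i) b (hv i hi) hVo ?_ ?_ ?_
    · exact hf.mono fun y hy => ⟨hy.1.1, (hiff y hy.1).1 hy.2⟩
    · intro y hyV hyi n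
      obtain ⟨C, hC⟩ := hb y hyV.1 ⟨i, hi, hyi⟩ n
      refine ⟨C, ?_⟩
      filter_upwards [hC, hVo.mem_nhds hyV] with z hz hzV hzi
      exact hz ((hiff z hzV).1 hzi)
    · intro y hyV hyi n k
      exact hj i hi y hyV.1 hyi (fun j hj hne => hyV.2 j (Finset.mem_erase.2 ⟨hne, hj⟩)) n k
  refine ⟨V, hVo.mem_nhds hxV, hG.congr fun y hyV => extendFrom_congr_of_nhdsWithin_eq ?_⟩
  -- the two regular sets coincide near `y`
  refine nhdsWithin_eq_nhdsWithin hyV hVo ?_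
  ext z
  simp only [mem_inter_iff, mem_setOf_eq]
  constructor
  · rintro ⟨⟨-, hall⟩, hzV⟩
    exact ⟨⟨hzV, hall i hi⟩, hzV⟩
  · rintro ⟨⟨hzV, hzi⟩, -⟩
    exact ⟨⟨hzV.1, (hiff z hzV).1 hzi⟩, hzV⟩

end Arrangement

/-! ### §2 The two noncompact walls of the rank-two angle chart -/

section Fin3

/-- **GLUING ACROSS THE WALLS `{x 0 = x 2}`, `{x 1 = x 2}` OF `Fin 3 → ℝ` FROM RAY-WORD JUMPS.**  `U` open in `Fin 3 → ℝ`; `f` `C^∞` on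
`U` off the two walls `{x 0 = x 2}` and `{x 1 = x 2}`; every jet `Dⁿf` bounded off the walls near each wall point of `U`; `v₀`, `v₁`
transversal to the respective walls (`v₀ 0 ≠ v₀ 2`, `v₁ 1 ≠ v₁ 2`); and at every SIMPLE point of each wall (on it, off the other) the
two one-sided limits of every coordinate-word ray jet `t ↦ Dⁿf (x + t • v) (e_{k 1}, …, e_{k n})` (`e_j = Pi.single j 1`) exist and
agree.  Then the glue `extendFrom (U ∩ {x 0 ≠ x 2 ∧ x 1 ≠ x 2}) f` is `C^∞` on `U` — across both walls and through their intersection,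
the diagonal corner line. [cite: Bouaziz1994IntegralesOrbitales, §3.2 (I₁)–(I₂) p. 579] -/
theorem contDiffOn_extendFrom_offWalls02_12_of_ray_basis {U : Set (Fin 3 → ℝ)} (hU : IsOpen U) {f : (Fin 3 → ℝ) → F}
    (hf : ContDiffOn ℝ ∞ f (U ∩ {x | x 0 ≠ x 2 ∧ x 1 ≠ x 2}))
    (hb : ∀ x ∈ U, (x 0 = x 2 ∨ x 1 = x 2) → ∀ n : ℕ, ∃ C : ℝ,
      ∀ᶠ y in 𝓝 x, (y 0 ≠ y 2 ∧ y 1 ≠ y 2) → ‖iteratedFDeriv ℝ n f y‖ ≤ C)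
    (v₀ v₁ : Fin 3 → ℝ) (hv₀ : v₀ 0 ≠ v₀ 2) (hv₁ : v₁ 1 ≠ v₁ 2)
    (hj₀ : ∀ x ∈ U, x 0 = x 2 → x 1 ≠ x 2 → ∀ (n : ℕ) (k : Fin n → Fin 3), ∃ l : F,
      Tendsto (fun t : ℝ => iteratedFDeriv ℝ n f (x + t • v₀) fun m => Pi.single (k m) 1) (𝓝[>] 0) (𝓝 l) ∧
      Tendsto (fun t : ℝ => iteratedFDeriv ℝ n f (x + t • v₀) fun m => Pi.single (k m) 1) (𝓝[<] 0) (𝓝 l))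
    (hj₁ : ∀ x ∈ U, x 1 = x 2 → x 0 ≠ x 2 → ∀ (n : ℕ) (k : Fin n → Fin 3), ∃ l : F,
      Tendsto (fun t : ℝ => iteratedFDeriv ℝ n f (x + t • v₁) fun m => Pi.single (k m) 1) (𝓝[>] 0) (𝓝 l) ∧
      Tendsto (fun t : ℝ => iteratedFDeriv ℝ n f (x + t • v₁) fun m => Pi.single (k m) 1) (𝓝[<] 0) (𝓝 l)) :
    ContDiffOn ℝ ∞ (extendFrom (U ∩ {x | x 0 ≠ x 2 ∧ x 1 ≠ x 2}) f) U := by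
  -- the two walls as an arrangement indexed by `Fin 2`
  let P : Fin 3 → (Fin 3 → ℝ) →L[ℝ] ℝ := fun j => ContinuousLinearMap.proj (R := ℝ) (φ := fun _ : Fin 3 => ℝ) j
  let L : Fin 2 → (Fin 3 → ℝ) →L[ℝ] ℝ := ![P 0 - P 2, P 1 - P 2]
  have hL0 : ∀ y : Fin 3 → ℝ, L 0 y = y 0 - y 2 := fun y => rfl
  have hL1 : ∀ y : Fin 3 → ℝ, L 1 y = y 1 - y 2 := fun y => rfl
  have hreg : {y : Fin 3 → ℝ | ∀ i ∈ (Finset.univ : Finset (Fin 2)), L i y ≠ (0 : Fin 2 → ℝ) i} =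
      {x | x 0 ≠ x 2 ∧ x 1 ≠ x 2} := by
    ext y
    simp only [Finset.mem_univ, forall_const, Fin.forall_fin_two, hL0, hL1, Pi.zero_apply, mem_setOf_eq, sub_ne_zero]
  have hwall : ∀ y : Fin 3 → ℝ, (∃ i ∈ (Finset.univ : Finset (Fin 2)), L i y = (0 : Fin 2 → ℝ) i) ↔ (y 0 = y 2 ∨ y 1 = y 2) := by
    intro y
    simp only [Finset.mem_univ, true_and, Fin.exists_fin_two, hL0, hL1, Pi.zero_apply, sub_eq_zero]
  have key := contDiffOn_extendFrom_of_arrangement_of_ray_basis L 0 (Pi.basisFun ℝ (Fin 3)) Finset.univ ?_ hU ?_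
    (f := f) (by rw [hreg]; exact hf) ?_ ![v₀, v₁] ?_ ?_
  · rw [hreg] at key
    exact key
  · -- the walls are nonzero forms
    intro i _
    fin_cases i
    · intro h
      have := congrArg (fun φ : (Fin 3 → ℝ) →L[ℝ] ℝ => φ (Pi.single 0 1)) h
      simp [hL0] at this
    · intro h
      have := congrArg (fun φ : (Fin 3 → ℝ) →L[ℝ] ℝ => φ (Pi.single 1 1)) h
      simp [hL1] at this
  · -- transversality: `e₁` lies in the wall `0` and leaves the wall `1`; `e₀` the other way round
    intro i _ x _ _
    fin_cases i
    · refine ⟨Pi.single 1 1, by simp [hL0], fun j _ hj _ => ?_⟩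
      fin_cases j
      · exact absurd rfl hj
      · simp [hL1]
    · refine ⟨Pi.single 0 1, by simp [hL1], fun j _ hj _ => ?_⟩
      fin_cases j
      · simp [hL0]
      · exact absurd rfl hj
  · -- jet bounds
    intro x hx hxw n
    obtain ⟨C, hC⟩ := hb x hx ((hwall x).1 hxw) n
    refine ⟨C, ?_⟩
    filter_upwards [hC] with y hy hyreg
    exact hy (by simpa only [mem_setOf_eq] using (Set.ext_iff.1 hreg y).1 hyreg)
  · -- transversal directions
    intro i _
    fin_cases i
    · simpa [hL0, sub_ne_zero] using hv₀
    · simpa [hL1, sub_ne_zero] using hv₁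
  · -- ray-word one-sided limits at simple points
    intro i _ x hx hxi hsim n k
    fin_cases i
    · have h02 : x 0 = x 2 := by simpa [hL0, sub_eq_zero] using hxi
      have h12 : x 1 ≠ x 2 := by
        have := hsim 1 (Finset.mem_univ _) (by decide)
        simpa [hL1, sub_ne_zero] using this
      simpa [Pi.basisFun_apply] using hj₀ x hx h02 h12 n k
    · have h12 : x 1 = x 2 := by simpa [hL1, sub_eq_zero] using hxi
      have h02 : x 0 ≠ x 2 := by
        have := hsim 0 (Finset.mem_univ _) (by decide)
        simpa [hL0, sub_ne_zero] using this
      simpa [Pi.basisFun_apply] using hj₁ x hx h12 h02 n k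

/-- **PACKAGED FORM: a `C^∞` function on `U` equal to `f` off the two walls.**  Under the hypotheses of
★ `contDiffOn_extendFrom_offWalls02_12_of_ray_basis` there is `g`, `C^∞` on `U`, with `g = f` on `U ∩ {x 0 ≠ x 2 ∧ x 1 ≠ x 2}`.
[cite: Bouaziz1994IntegralesOrbitales, §3.2 (I₁)–(I₂) p. 579] -/
theorem exists_contDiffOn_eqOn_offWalls02_12_of_ray_basis {U : Set (Fin 3 → ℝ)} (hU : IsOpen U) {f : (Fin 3 → ℝ) → F}
    (hf : ContDiffOn ℝ ∞ f (U ∩ {x | x 0 ≠ x 2 ∧ x 1 ≠ x 2}))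
    (hb : ∀ x ∈ U, (x 0 = x 2 ∨ x 1 = x 2) → ∀ n : ℕ, ∃ C : ℝ,
      ∀ᶠ y in 𝓝 x, (y 0 ≠ y 2 ∧ y 1 ≠ y 2) → ‖iteratedFDeriv ℝ n f y‖ ≤ C)
    (v₀ v₁ : Fin 3 → ℝ) (hv₀ : v₀ 0 ≠ v₀ 2) (hv₁ : v₁ 1 ≠ v₁ 2)
    (hj₀ : ∀ x ∈ U, x 0 = x 2 → x 1 ≠ x 2 → ∀ (n : ℕ) (k : Fin n → Fin 3), ∃ l : F,
      Tendsto (fun t : ℝ => iteratedFDeriv ℝ n f (x + t • v₀) fun m => Pi.single (k m) 1) (𝓝[>] 0) (𝓝 l) ∧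
      Tendsto (fun t : ℝ => iteratedFDeriv ℝ n f (x + t • v₀) fun m => Pi.single (k m) 1) (𝓝[<] 0) (𝓝 l))
    (hj₁ : ∀ x ∈ U, x 1 = x 2 → x 0 ≠ x 2 → ∀ (n : ℕ) (k : Fin n → Fin 3), ∃ l : F,
      Tendsto (fun t : ℝ => iteratedFDeriv ℝ n f (x + t • v₁) fun m => Pi.single (k m) 1) (𝓝[>] 0) (𝓝 l) ∧
      Tendsto (fun t : ℝ => iteratedFDeriv ℝ n f (x + t • v₁) fun m => Pi.single (k m) 1) (𝓝[<] 0) (𝓝 l)) :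
    ∃ g : (Fin 3 → ℝ) → F, ContDiffOn ℝ ∞ g U ∧ EqOn g f (U ∩ {x | x 0 ≠ x 2 ∧ x 1 ≠ x 2}) :=
  ⟨_, contDiffOn_extendFrom_offWalls02_12_of_ray_basis hU hf hb v₀ v₁ hv₀ hv₁ hj₀ hj₁,
    fun y hy => extendFrom_extends hf.continuousOn y hy⟩

end Fin3

/-! ### §3 One basis PER WALL (the adapted letters of the one-place jump relations) -/

section ArrangementBases

variable {ι : Type*} (ℓ : ι → E →L[ℝ] ℝ) (a : ι → ℝ)

/-- **RAY CONSUMER FORM, ONE BASIS PER WALL.**  As ★ `contDiffOn_extendFrom_of_arrangement_of_ray_basis`, but the words at the simple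
points of the wall `i` are drawn from a basis `b i` that may depend on the wall (Harish-Chandra's jump relations are written in letters
ADAPTED to the wall: normal `e_i − e_j`, tangential `e_i + e_j`, third `e_k`). [cite: Bouaziz1994IntegralesOrbitales, §3.2 (I₁)–(I₂) p. 579] -/
theorem contDiffOn_extendFrom_of_arrangement_of_ray_bases {κ : Type*} (b : ι → Module.Basis κ ℝ E) (T : Finset ι)
    (hℓ : ∀ i ∈ T, ℓ i ≠ 0) {U : Set E} (hU : IsOpen U)
    (htrans : ∀ i ∈ T, ∀ x ∈ U, ℓ i x = a i → ∃ v : E, ℓ i v = 0 ∧ ∀ j ∈ T, j ≠ i → ℓ j x = a j → ℓ j v ≠ 0)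
    {f : E → F} (hf : ContDiffOn ℝ ∞ f (U ∩ {y | ∀ i ∈ T, ℓ i y ≠ a i}))
    (hb : ∀ x ∈ U, (∃ i ∈ T, ℓ i x = a i) → ∀ n : ℕ, ∃ C : ℝ, ∀ᶠ y in 𝓝 x, (∀ i ∈ T, ℓ i y ≠ a i) → ‖iteratedFDeriv ℝ n f y‖ ≤ C)
    (v : ι → E) (hv : ∀ i ∈ T, ℓ i (v i) ≠ 0)
    (hj : ∀ i ∈ T, ∀ x ∈ U, ℓ i x = a i → (∀ j ∈ T, j ≠ i → ℓ j x ≠ a j) → ∀ (n : ℕ) (k : Fin n → κ), ∃ l : F,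
      Tendsto (fun t : ℝ => iteratedFDeriv ℝ n f (x + t • v i) fun m => b i (k m)) (𝓝[>] 0) (𝓝 l) ∧
      Tendsto (fun t : ℝ => iteratedFDeriv ℝ n f (x + t • v i) fun m => b i (k m)) (𝓝[<] 0) (𝓝 l)) :
    ContDiffOn ℝ ∞ (extendFrom (U ∩ {y | ∀ i ∈ T, ℓ i y ≠ a i}) f) U := by
  classical
  refine contDiffOn_extendFrom_of_arrangement ℓ a T hℓ hU htrans hf hb fun i hi x hx hxi hsim => ?_
  -- a neighbourhood `V` of the simple point `x` inside `U` avoiding the other walls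
  set V : Set E := U ∩ {y | ∀ j ∈ T.erase i, ℓ j y ≠ a j} with hVdef
  have hVo : IsOpen V := hU.inter (isOpen_setOf_forall_apply_ne ℓ a (T.erase i))
  have hxV : x ∈ V := ⟨hx, fun j hj => hsim j (Finset.mem_of_mem_erase hj) (Finset.ne_of_mem_erase hj)⟩
  have hiff : ∀ y ∈ V, (ℓ i y ≠ a i ↔ ∀ j ∈ T, ℓ j y ≠ a j) := by
    intro y hyV
    refine ⟨fun hyi j hj => ?_, fun h => h i hi⟩
    by_cases hji : j = i
    · subst hji; exact hyi
    · exact hyV.2 j (Finset.mem_erase.2 ⟨hji, hj⟩)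
  -- one-wall gluing on `V`, words from the basis `b i`
  have hG : ContDiffOn ℝ ∞ (extendFrom (V ∩ {y | ℓ i y ≠ a i}) f) V := by
    refine contDiffOn_extendFrom_of_tendsto_iteratedFDeriv_ray_basis (ℓ i) (a i) (b i) (hv i hi) hVo ?_ ?_ ?_
    · exact hf.mono fun y hy => ⟨hy.1.1, (hiff y hy.1).1 hy.2⟩
    · intro y hyV hyi n
      obtain ⟨C, hC⟩ := hb y hyV.1 ⟨i, hi, hyi⟩ n
      refine ⟨C, ?_⟩
      filter_upwards [hC, hVo.mem_nhds hyV] with z hz hzV hzi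
      exact hz ((hiff z hzV).1 hzi)
    · intro y hyV hyi n k
      exact hj i hi y hyV.1 hyi (fun j hj hne => hyV.2 j (Finset.mem_erase.2 ⟨hne, hj⟩)) n k
  refine ⟨V, hVo.mem_nhds hxV, hG.congr fun y hyV => extendFrom_congr_of_nhdsWithin_eq ?_⟩
  refine nhdsWithin_eq_nhdsWithin hyV hVo ?_
  ext z
  simp only [mem_inter_iff, mem_setOf_eq]
  constructor
  · rintro ⟨⟨-, hall⟩, hzV⟩
    exact ⟨⟨hzV, hall i hi⟩, hzV⟩
  · rintro ⟨⟨hzV, hzi⟩, -⟩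
    exact ⟨⟨hzV.1, (hiff z hzV).1 hzi⟩, hzV⟩

end ArrangementBases

/-! ### §4 The two noncompact walls of `Fin 3 → ℝ` with wall-adapted bases and the normal rays `e_i − e_2` -/

section Fin3Adapted

/-- **GLUING ACROSS `{x 0 = x 2}`, `{x 1 = x 2}` FROM ADAPTED RAY-WORD JUMPS** — the currency of the one-place jump relations: across the wall
`{x i = x 2}` (`i = 0, 1`) the rays are the normal lines `x + t • (e_i − e_2)` and the words are drawn from a basis `bᵢ` of `ℝ³` attached to
that wall (e.g. `e_i − e_2, e_i + e_2, e_k`).  `U` open, `f` `C^∞` on `U` off the two walls, jets bounded off the walls near wall points, and at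
every simple point of each wall all adapted ray-word jets have equal one-sided limits.  Then the glue is `C^∞` on `U`.
[cite: Bouaziz1994IntegralesOrbitales, §3.2 (I₁)–(I₂) p. 579] -/
theorem contDiffOn_extendFrom_offWalls02_12_of_adapted_ray_jumps {U : Set (Fin 3 → ℝ)} (hU : IsOpen U) {f : (Fin 3 → ℝ) → F}
    (hf : ContDiffOn ℝ ∞ f (U ∩ {x | x 0 ≠ x 2 ∧ x 1 ≠ x 2}))
    (hb : ∀ x ∈ U, (x 0 = x 2 ∨ x 1 = x 2) → ∀ n : ℕ, ∃ C : ℝ,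
      ∀ᶠ y in 𝓝 x, (y 0 ≠ y 2 ∧ y 1 ≠ y 2) → ‖iteratedFDeriv ℝ n f y‖ ≤ C)
    (b₀ b₁ : Module.Basis (Fin 3) ℝ (Fin 3 → ℝ))
    (hj₀ : ∀ x ∈ U, x 0 = x 2 → x 1 ≠ x 2 → ∀ (n : ℕ) (k : Fin n → Fin 3), ∃ l : F,
      Tendsto (fun t : ℝ => iteratedFDeriv ℝ n f (x + t • ((Pi.single 0 1 : Fin 3 → ℝ) - Pi.single 2 1)) fun m => b₀ (k m)) (𝓝[>] 0) (𝓝 l) ∧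
      Tendsto (fun t : ℝ => iteratedFDeriv ℝ n f (x + t • ((Pi.single 0 1 : Fin 3 → ℝ) - Pi.single 2 1)) fun m => b₀ (k m)) (𝓝[<] 0) (𝓝 l))
    (hj₁ : ∀ x ∈ U, x 1 = x 2 → x 0 ≠ x 2 → ∀ (n : ℕ) (k : Fin n → Fin 3), ∃ l : F,
      Tendsto (fun t : ℝ => iteratedFDeriv ℝ n f (x + t • ((Pi.single 1 1 : Fin 3 → ℝ) - Pi.single 2 1)) fun m => b₁ (k m)) (𝓝[>] 0) (𝓝 l) ∧
      Tendsto (fun t : ℝ => iteratedFDeriv ℝ n f (x + t • ((Pi.single 1 1 : Fin 3 → ℝ) - Pi.single 2 1)) fun m => b₁ (k m)) (𝓝[<] 0) (𝓝 l)) :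
    ContDiffOn ℝ ∞ (extendFrom (U ∩ {x | x 0 ≠ x 2 ∧ x 1 ≠ x 2}) f) U := by
  -- the two walls as an arrangement indexed by `Fin 2`
  let P : Fin 3 → (Fin 3 → ℝ) →L[ℝ] ℝ := fun j => ContinuousLinearMap.proj (R := ℝ) (φ := fun _ : Fin 3 => ℝ) j
  let L : Fin 2 → (Fin 3 → ℝ) →L[ℝ] ℝ := ![P 0 - P 2, P 1 - P 2]
  have hL0 : ∀ y : Fin 3 → ℝ, L 0 y = y 0 - y 2 := fun y => rfl
  have hL1 : ∀ y : Fin 3 → ℝ, L 1 y = y 1 - y 2 := fun y => rfl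
  have hreg : {y : Fin 3 → ℝ | ∀ i ∈ (Finset.univ : Finset (Fin 2)), L i y ≠ (0 : Fin 2 → ℝ) i} =
      {x | x 0 ≠ x 2 ∧ x 1 ≠ x 2} := by
    ext y
    simp only [Finset.mem_univ, forall_const, Fin.forall_fin_two, hL0, hL1, Pi.zero_apply, mem_setOf_eq, sub_ne_zero]
  have hwall : ∀ y : Fin 3 → ℝ, (∃ i ∈ (Finset.univ : Finset (Fin 2)), L i y = (0 : Fin 2 → ℝ) i) ↔ (y 0 = y 2 ∨ y 1 = y 2) := by
    intro y
    simp only [Finset.mem_univ, true_and, Fin.exists_fin_two, hL0, hL1, Pi.zero_apply, sub_eq_zero]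
  have key := contDiffOn_extendFrom_of_arrangement_of_ray_bases L 0 ![b₀, b₁] Finset.univ ?_ hU ?_
    (f := f) (by rw [hreg]; exact hf) ?_ ![(Pi.single 0 1 : Fin 3 → ℝ) - Pi.single 2 1, (Pi.single 1 1 : Fin 3 → ℝ) - Pi.single 2 1] ?_ ?_
  · rw [hreg] at key
    exact key
  · -- the walls are nonzero forms
    intro i _
    fin_cases i
    · intro h
      have := congrArg (fun φ : (Fin 3 → ℝ) →L[ℝ] ℝ => φ (Pi.single 0 1)) h
      simp [hL0] at this
    · intro h
      have := congrArg (fun φ : (Fin 3 → ℝ) →L[ℝ] ℝ => φ (Pi.single 1 1)) h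
      simp [hL1] at this
  · -- transversality: `e₁` lies in the wall `0` and leaves the wall `1`; `e₀` the other way round
    intro i _ x _ _
    fin_cases i
    · refine ⟨Pi.single 1 1, by simp [hL0], fun j _ hj _ => ?_⟩
      fin_cases j
      · exact absurd rfl hj
      · simp [hL1]
    · refine ⟨Pi.single 0 1, by simp [hL1], fun j _ hj _ => ?_⟩
      fin_cases j
      · simp [hL0]
      · exact absurd rfl hj
  · -- jet bounds
    intro x hx hxw n
    obtain ⟨C, hC⟩ := hb x hx ((hwall x).1 hxw) n
    refine ⟨C, ?_⟩
    filter_upwards [hC] with y hy hyreg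
    exact hy (by simpa only [mem_setOf_eq] using (Set.ext_iff.1 hreg y).1 hyreg)
  · -- the normal rays are transversal: `(e_i − e_2)_i − (e_i − e_2)_2 = 2`
    intro i _
    fin_cases i
    · simp [hL0]
    · simp [hL1]
  · -- adapted ray-word one-sided limits at simple points
    intro i _ x hx hxi hsim n k
    fin_cases i
    · have h02 : x 0 = x 2 := by simpa [hL0, sub_eq_zero] using hxi
      have h12 : x 1 ≠ x 2 := by
        have := hsim 1 (Finset.mem_univ _) (by decide)
        simpa [hL1, sub_ne_zero] using this
      simpa using hj₀ x hx h02 h12 n k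
    · have h12 : x 1 = x 2 := by simpa [hL1, sub_eq_zero] using hxi
      have h02 : x 0 ≠ x 2 := by
        have := hsim 0 (Finset.mem_univ _) (by decide)
        simpa [hL0, sub_ne_zero] using this
      simpa using hj₁ x hx h12 h02 n k

/-- **PACKAGED FORM (adapted letters): a `C^∞` function on `U` equal to `f` off the two walls.**
[cite: Bouaziz1994IntegralesOrbitales, §3.2 (I₁)–(I₂) p. 579] -/
theorem exists_contDiffOn_eqOn_offWalls02_12_of_adapted_ray_jumps {U : Set (Fin 3 → ℝ)} (hU : IsOpen U) {f : (Fin 3 → ℝ) → F}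
    (hf : ContDiffOn ℝ ∞ f (U ∩ {x | x 0 ≠ x 2 ∧ x 1 ≠ x 2}))
    (hb : ∀ x ∈ U, (x 0 = x 2 ∨ x 1 = x 2) → ∀ n : ℕ, ∃ C : ℝ,
      ∀ᶠ y in 𝓝 x, (y 0 ≠ y 2 ∧ y 1 ≠ y 2) → ‖iteratedFDeriv ℝ n f y‖ ≤ C)
    (b₀ b₁ : Module.Basis (Fin 3) ℝ (Fin 3 → ℝ))
    (hj₀ : ∀ x ∈ U, x 0 = x 2 → x 1 ≠ x 2 → ∀ (n : ℕ) (k : Fin n → Fin 3), ∃ l : F,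
      Tendsto (fun t : ℝ => iteratedFDeriv ℝ n f (x + t • ((Pi.single 0 1 : Fin 3 → ℝ) - Pi.single 2 1)) fun m => b₀ (k m)) (𝓝[>] 0) (𝓝 l) ∧
      Tendsto (fun t : ℝ => iteratedFDeriv ℝ n f (x + t • ((Pi.single 0 1 : Fin 3 → ℝ) - Pi.single 2 1)) fun m => b₀ (k m)) (𝓝[<] 0) (𝓝 l))
    (hj₁ : ∀ x ∈ U, x 1 = x 2 → x 0 ≠ x 2 → ∀ (n : ℕ) (k : Fin n → Fin 3), ∃ l : F,
      Tendsto (fun t : ℝ => iteratedFDeriv ℝ n f (x + t • ((Pi.single 1 1 : Fin 3 → ℝ) - Pi.single 2 1)) fun m => b₁ (k m)) (𝓝[>] 0) (𝓝 l) ∧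
      Tendsto (fun t : ℝ => iteratedFDeriv ℝ n f (x + t • ((Pi.single 1 1 : Fin 3 → ℝ) - Pi.single 2 1)) fun m => b₁ (k m)) (𝓝[<] 0) (𝓝 l)) :
    ∃ g : (Fin 3 → ℝ) → F, ContDiffOn ℝ ∞ g U ∧ EqOn g f (U ∩ {x | x 0 ≠ x 2 ∧ x 1 ≠ x 2}) :=
  ⟨_, contDiffOn_extendFrom_offWalls02_12_of_adapted_ray_jumps hU hf hb b₀ b₁ hj₀ hj₁,
    fun y hy => extendFrom_extends hf.continuousOn y hy⟩

end Fin3Adapted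

end Literature.Analysis.Calculus
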